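import Literature.AlgebraicGeometry.Resolution.Kuhlmann2019Lemma43Reduction
import Literature.AlgebraicGeometry.Resolution.HenselizationGeneratorApproximation
import Mathlib.Data.Nat.Factorization.Basic
import HarnessLib

/-!
# Kuhlmann 2019, Lemma 4.3 (mixed characteristic normal form): the second case (Ershov's cascade)

Topic: `Literature/AlgebraicGeometry/Resolution` (valued function fields). Completion of the
proof of the hypothesis `(H43)` of `Kuhlmann2019_Prop52_sepClosed.of_normalForms`
(`Kuhlmann2019DegreePStepAssembly.lean`): the SECOND CASE of F.-V. Kuhlmann, *Elimination of
ramification II: Henselian rationality*, Israel J. Math. 234 (2019) = arXiv:1701.05508,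
**Lemma 4.3** (pp. 9–10 of the arXiv text), continuing `Kuhlmann2019Lemma43Reduction.lean`:

> Now we consider the second case: all monomials in `g̃(y)` have value `> vp`. … We will work
> with polynomials of the following form: (4.18) `h*(Y,Z) = ∑_{i=0}^n h_i(Z)(Y − Z)^i ∈
> p𝓜_K[Y,Z]`. … we will call `(h*(Y,Z), α)` an admissible pair if for all `c ∈ K` with
> `v(y−c) ≥ α`, a) the values `vh_i(c)` are fixed for all `i`, b) the values of the nonzero
> summands `h_i(c)(y−c)^i` are distinct, c) `1 + h*(y,c) ∈ (1+f)·(K(x)^h)^p`. Then for large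
> enough `α`, `(∑ g̃_i(Z)(Y − Z)^i, α)` … is an admissible pair. Let us fix an admissible pair
> for which the number of nonzero monomials in `h*(Y,Z)` is the smallest possible. … If
> `m ≥ 1`, `(p,i) = 1`, and the summand `h_{ip^m}(c)(y−c)^{ip^m}` is nonzero, then we use
> part c) of Lemma 3.1 `m` many times to replace this summand by
> `Δ^m(h_{ip^m}(c)(y−c)^{ip^m}) = Δ^m(1)·h_{ip^m}(c)^{1/p^m}(y−c)^i`. In this way we turn
> `h*(y,c)` into a polynomial `h_0(c) + ∑_{1≤i≤n, p∤i} r_i(c)(y−c)^i` … we wish to show that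
> for each `i` the value `vr_i(c)` is fixed … it suffices to show that the values
> `vΔ^m(h_{ip^m}(c)) = δ^m(vh_{ip^m}(c))` are distinct … Suppose that there are `ℓ > m ≥ 0`
> with `ip^ℓ ≤ n` such that `δ^ℓ(vh_{ip^ℓ}(c)) = δ^m(vh_{ip^m}(c))`. … `Δ^{-1}` can be applied
> `ℓ − m` many times in order to replace the summand `h_{ip^m}(c)(y−c)^{ip^m}` by
> `Δ^{m−ℓ}(1)·h_{ip^m}(c)^{p^{ℓ−m}}(y−c)^{ip^ℓ}` … So the new polynomial `h̃*`, say, has less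
> monomials than `h*` … contradicting the minimality … Again, as `v(y−K)` has no largest
> element, we can choose some `c₂ ∈ K` with `v(y−c₂)` so large that the values
> `vr_i(c₂)(y−c₂)^i` are distinct. … there is some `b ∈ K` with `v((y−c₂)/b) = 0`. We set
> `z = (y−c₂)/b` and `a_i = r_i(c₂)bⁱ ∈ 𝓜_K`. Then `vz = 0`. … Hence also in the second case,
> the assertions of our lemma are satisfied.

Here `Δ(a) = −pa^{1/p}` (any `p`-th root), `Δ^{-1}(d) = (−d/p)^p`, `δ(γ) = vp + γ/p`
(§3 of the paper; Lemma 3.1 c) = Kuhlmann 2010, Cor. 2.11 d), `exists_sub_mul_eq_mul_pow`).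

## Content (everything PROVED; no definition, no named fact)

* value bookkeeping for `Δ` and `Δ^{-1}` in root-free form:
  `v(Δ^m(a))^{p^m} = v(p)^{p+…+p^m}·v(a)`, `v(Δ^{-e}(d))·v(p)^{p+…+p^e} = v(d)^{p^e}`;
* `exists_theta_chain`, `exists_delta_chain` — iterated Lemma 3.1 c) backwards/forwards inside
  `(1 + ·)·(F^×)^p`;
* the cascade: families `h_j ∈ K[Z]` (`j ≤ n`) with `1 + g̃(y) ∈ (1 + ∑_j h_j(c)(y−c)^j)·(F^×)^p`
  and all `h_j(c)(y−c)^j` of value `> vp` for `c ↗ y` ("admissible"); the values `vh_j(c)` are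
  eventually `vh_j(y)` (Kaplansky, `EventualDominance.lean`), so a coincidence
  `δ^ℓ(vh_{ip^ℓ}) = δ^m(vh_{ip^m})` is the root-free identity
  `v(h_M(y))^{p^e} = v(p)^{p+…+p^e}·v(h_{Mp^e}(y))`; `merge_step` removes a monomial under a
  coincidence, `terminal_step` produces the normal form when there is none, and
  `normalForm43_caseTwo` is the induction on the number of non-zero `h_j`, `j ≥ 1`.

## Sources

* [K19] F.-V. Kuhlmann, Israel J. Math. 234 (2019) = arXiv:1701.05508: §3 (Lemma 3.1, `Δ`,
  `δ`), Lemma 4.3 (second case), Remark after it (Ershov's correction). [Kuhlmann2019]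
* [Er] Yu. L. Ershov, *On Henselian rationality of extensions*, Dokl. Math. 78 (2008) 724–728.
* [K10] F.-V. Kuhlmann, Trans. AMS 362 (2010) = arXiv:1003.5678: Cor. 2.11 d). [Kuhlmann2010]

## Rendering notes

As in `Kuhlmann2019Lemma43Reduction.lean`. The printed minimal-counterexample argument over
"admissible pairs" is rendered as an induction on the number of non-zero coefficient
polynomials `h_j`, `1 ≤ j ≤ n`; condition a) of admissibility is Kaplansky's lemma
(`approach_valuation_eval_eq`: `vh_j(c) = vh_j(y)` for `c ↗ y`), condition b) is only needed,
and only established, at the final centre `c₂` (`approach_exists_strict_winner`). The `p`-th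
roots `a^{1/p}` are taken in `K` by one fixed choice function (`K` algebraically closed);
`Δ^m` is applied to the coefficient `h_{ip^m}(c)`, the monomial becoming
`Δ^m(h_{ip^m}(c))·(y−c)^i`, which is the printed `Δ^m(h_{ip^m}(c)(y−c)^{ip^m})` up to the choice
of roots (same value). Exponents `j ≥ 1` are decomposed as `j = i·p^m`, `p ∤ i`, by
`m = j.factorization p`.
-/

noncomputable section

open IsLocalRing Polynomial Finset

namespace Literature.AlgebraicGeometry.Resolution

universe u

variable {Ω : Type u} [Field Ω] (V : ValuationSubring Ω)

/-! ### Root-free value bookkeeping for `Δ^{-1}(d) = (−d/p)^p` and `Δ(a) = −p·a^{1/p}` -/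

section Values

variable {p : ℕ} (hp0 : (p : Ω) ≠ 0)
include hp0

/-- `v((−d/p)^p)·v(p)^p = v(d)^p`. [folklore] -/
theorem valuation_theta_mul (d : Ω) :
    V.valuation ((-d / p) ^ p) * V.valuation (p : Ω) ^ p = V.valuation d ^ p := by
  rw [map_pow, map_div₀, Valuation.map_neg, div_pow,
    div_mul_cancel₀ _ (pow_ne_zero _ ((_root_.map_ne_zero _).mpr hp0))]

/-- `v(Δ^{-e}(d))·v(p)^{p+…+p^e} = v(d)^{p^e}` for `Δ^{-1}(d) = (−d/p)^p`. [folklore] -/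
theorem valuation_theta_iterate_mul (e : ℕ) (d : Ω) :
    V.valuation ((fun x : Ω => (-x / p) ^ p)^[e] d) * V.valuation (p : Ω) ^ (∑ k ∈ range e, p ^ (k + 1)) =
      V.valuation d ^ (p ^ e) := by
  induction e generalizing d with
  | zero => simp
  | succ e ih =>
    rw [Function.iterate_succ_apply, sum_range_succ, pow_add, ← mul_assoc, ih ((-d / p) ^ p),
      pow_succ' p e, pow_mul, ← mul_pow, valuation_theta_mul V hp0, ← pow_mul]

variable {rt : Ω → Ω} (hrt : ∀ a, rt a ^ p = a)
include hrt

omit hp0 in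
/-- `v(−p·a^{1/p})^p = v(p)^p·v(a)`. [folklore] -/
theorem valuation_delta_pow (a : Ω) :
    V.valuation (-(p : Ω) * rt a) ^ p = V.valuation (p : Ω) ^ p * V.valuation a := by
  rw [map_mul, Valuation.map_neg, mul_pow, ← map_pow V.valuation (rt a) p, hrt]

omit hp0 in
/-- `v(Δ^m(a))^{p^m} = v(p)^{p+…+p^m}·v(a)` for `Δ(a) = −p·a^{1/p}`. [folklore] -/
theorem valuation_delta_iterate_pow (m : ℕ) (a : Ω) :
    V.valuation ((fun x : Ω => -(p : Ω) * rt x)^[m] a) ^ (p ^ m) =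
      V.valuation (p : Ω) ^ (∑ k ∈ range m, p ^ (k + 1)) * V.valuation a := by
  induction m with
  | zero => simp
  | succ m ih =>
    rw [Function.iterate_succ_apply', pow_succ' p m, pow_mul, valuation_delta_pow V hrt, mul_pow,
      ← pow_mul, ih, sum_range_succ, pow_add, ← pow_succ']
    ac_rfl

end Values

/-- Cancellation on the right in the value group. [folklore] -/
theorem le_of_mul_le_mul_right_val {a b c : V.ValueGroup} (hc : c ≠ 0) (h : a * c ≤ b * c) : a ≤ b := by
  have := mul_le_mul_left h c⁻¹
  rwa [mul_inv_cancel_right₀ hc, mul_inv_cancel_right₀ hc] at this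

/-- Powers are injective on values. [folklore] -/
theorem pow_injective_val {a b : V.ValueGroup} {n : ℕ} (hn : n ≠ 0) (h : a ^ n = b ^ n) : a = b :=
  le_antisymm (le_of_pow_le_pow_left₀ hn zero_le h.le) (le_of_pow_le_pow_left₀ hn zero_le h.ge)

/-- **The values along a `Δ^{-1}`-chain are monotone**, hence bounded by the end values: if
`v(d) < β` and `v(Δ^{-e}(d)) < β` then `v(Δ^{-k}(d)) < β` for all `k ≤ e` (the affine map `δ^{-1}`
is increasing). [folklore] -/
theorem valuation_theta_iterate_lt_of_ends {p : ℕ} (hp : p.Prime) (hp0 : (p : Ω) ≠ 0) {d : Ω}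
    {β : V.ValueGroup} {e : ℕ} (h0 : V.valuation d < β)
    (he : V.valuation ((fun x : Ω => (-x / p) ^ p)^[e] d) < β) :
    ∀ k, k ≤ e → V.valuation ((fun x : Ω => (-x / p) ^ p)^[k] d) < β := by
  set θ : Ω → Ω := fun x => (-x / p) ^ p with hθ
  have hvp : 0 < V.valuation (p : Ω) ^ p := pow_pos ((Valuation.pos_iff _).mpr hp0) p
  -- one step of monotonicity: `v(x) ≤ v(x')` iff `v(θ x) ≤ v(θ x')`
  have hstep : ∀ x x' : Ω, V.valuation x ≤ V.valuation x' ↔ V.valuation (θ x) ≤ V.valuation (θ x') := by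
    intro x x'
    rw [← pow_le_pow_iff_left₀ (zero_le) (zero_le) hp.ne_zero (a := V.valuation x),
      ← valuation_theta_mul V hp0 x, ← valuation_theta_mul V hp0 x']
    constructor
    · intro h; exact le_of_mul_le_mul_right_val V hvp.ne' h
    · intro h; exact mul_le_mul_left h _
  have hsucc : ∀ k, θ^[k + 1] d = θ (θ^[k] d) := fun k => Function.iterate_succ_apply' θ k d
  -- the chain is monotone in one direction
  rcases le_total (V.valuation d) (V.valuation (θ d)) with hup | hdown
  · -- increasing: every term is `≤` the last one
    have hmono : ∀ k, V.valuation (θ^[k] d) ≤ V.valuation (θ^[k + 1] d) := by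
      intro k
      induction k with
      | zero => simpa using hup
      | succ k ih => rw [hsucc (k + 1), hsucc k]; exact (hstep _ _).mp (by rwa [← hsucc k])
    have hle : ∀ k j, k ≤ j → V.valuation (θ^[k] d) ≤ V.valuation (θ^[j] d) := by
      intro k j hkj
      induction j, hkj using Nat.le_induction with
      | base => exact le_rfl
      | succ j _ ih => exact ih.trans (hmono j)
    exact fun k hk => (hle k e hk).trans_lt he
  · -- decreasing: every term is `≤` the first one
    have hmono : ∀ k, V.valuation (θ^[k + 1] d) ≤ V.valuation (θ^[k] d) := by
      intro k
      induction k with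
      | zero => simpa using hdown
      | succ k ih => rw [hsucc (k + 1), hsucc k]; exact (hstep _ _).mp (by rwa [← hsucc k])
    have hle : ∀ k, V.valuation (θ^[k] d) ≤ V.valuation d := by
      intro k
      induction k with
      | zero => exact le_rfl
      | succ k ih => exact (hmono k).trans ih
    exact fun k _ => (hle k).trans_lt h0

/-! ### A choice of `p`-th roots inside `K` -/

/-- A `p`-th root function on `Ω` taking `K` to `K` (`K`, `Ω` algebraically closed). [folklore] -/
theorem exists_root_function [IsAlgClosed Ω] (K : Subfield Ω) (hK : IsAlgClosed K) {n : ℕ} (hn : 0 < n) :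
    ∃ rt : Ω → Ω, (∀ a, rt a ^ n = a) ∧ ∀ a ∈ K, rt a ∈ K := by
  have h : ∀ a : Ω, ∃ r : Ω, r ^ n = a ∧ (a ∈ K → r ∈ K) := by
    intro a
    by_cases ha : a ∈ K
    · obtain ⟨r, hr⟩ := IsAlgClosed.exists_pow_nat_eq (⟨a, ha⟩ : K) hn
      exact ⟨r, by simpa using congrArg Subtype.val hr, fun _ => r.2⟩
    · obtain ⟨r, hr⟩ := IsAlgClosed.exists_pow_nat_eq a hn
      exact ⟨r, hr, fun h => absurd h ha⟩
  choose rt h1 h2 using h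
  exact ⟨rt, h1, h2⟩

/-! ### Iterated Lemma 3.1 c) inside `(1 + ·)·(F^×)^p` -/

section Chains

variable {p : ℕ} [hp : Fact p.Prime] {K F : Subfield Ω} (hKF : K ≤ F)
  (hF : IsHenselianField F (V.comap (algebraMap F Ω)))
  {C : Ω} (hCK : C ∈ K) (hC : C ^ (p - 1) = -(p : Ω)) (hp0 : (p : Ω) ≠ 0)
  (hvp : V.valuation (p : Ω) < 1)
include hKF hF hCK hC hp0 hvp

/-- **Backward chain** (`Δ^{-1}` applied `e` times, Lemma 3.1 c) = Cor. 2.11 d) read from right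
to left): for `b, d ∈ F` with `v(b) ≤ v(C)` and `v(Δ^{-k}(d)) < v(p)` for `1 ≤ k ≤ e`,
`1 + b + d ∈ (1 + b + Δ^{-e}(d))·(F^×)^p`. [cite: Kuhlmann2019, Lemma 3.1 c) and (3.3)] -/
theorem exists_theta_chain {b : Ω} (hbF : b ∈ F) (hb : V.valuation b ≤ V.valuation C) {d : Ω}
    (hdF : d ∈ F) (e : ℕ)
    (hsmall : ∀ k, 1 ≤ k → k ≤ e → V.valuation ((fun x : Ω => (-x / p) ^ p)^[k] d) < V.valuation (p : Ω)) :
    ∃ w ∈ F, w ≠ 0 ∧ 1 + b + d = (1 + b + (fun x : Ω => (-x / p) ^ p)^[e] d) * w ^ p := by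
  have hpr : p.Prime := hp.out
  set θ : Ω → Ω := fun x => (-x / p) ^ p with hθ
  have hpF : (p : Ω) ∈ F := natCast_mem F p
  have hθF : ∀ x ∈ F, θ x ∈ F := fun x hx => pow_mem (div_mem (neg_mem hx) hpF) p
  have hθiF : ∀ k, θ^[k] d ∈ F := by
    intro k
    induction k with
    | zero => exact hdF
    | succ k ih => rw [Function.iterate_succ_apply']; exact hθF _ ih
  induction e with
  | zero => exact ⟨1, F.one_mem, one_ne_zero, by simp⟩
  | succ e ih =>
    obtain ⟨w₁, hw₁F, hw₁0, hw₁⟩ := ih fun k hk hke => hsmall k hk (by omega)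
    set x : Ω := θ^[e] d with hx
    set c' : Ω := -x / p with hc'
    have hc'F : c' ∈ F := div_mem (neg_mem (hθiF e)) hpF
    have hxc' : x = -(p : Ω) * c' := by rw [hc']; field_simp
    have hc'p : c' ^ p = θ^[e + 1] d := by rw [Function.iterate_succ_apply']
    have hvc' : V.valuation c' ^ p < V.valuation (p : Ω) := by
      rw [← map_pow, hc'p]; exact hsmall (e + 1) (by omega) le_rfl
    obtain ⟨w₂, hw₂F, hw₂0, hw₂⟩ :=
      exists_sub_mul_eq_mul_pow V hF hpr (hKF hCK) hC hp0 hvp hbF hc'F hb hvc'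
    refine ⟨w₂ * w₁, mul_mem hw₂F hw₁F, mul_ne_zero hw₂0 hw₁0, ?_⟩
    rw [hw₁, hxc', show (1 + b + -(p : Ω) * c') = 1 + b - p * c' by ring, hw₂, hc'p, mul_pow]
    ring

variable {rt : Ω → Ω} (hrt : ∀ a, rt a ^ p = a) (hrtK : ∀ a ∈ K, rt a ∈ K)
include hrt hrtK

/-- **Forward chain** (`Δ` applied `m` times to the coefficient, Lemma 3.1 c) = Cor. 2.11 d)):
for `b ∈ F` with `v(b) ≤ v(C)`, `a ∈ K`, `t ∈ F`, and `v(a·t^{ip^m}) < v(p)`,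
`1 + b + a·t^{ip^m} ∈ (1 + b + Δ^m(a)·tⁱ)·(F^×)^p`; moreover `v(Δ^m(a)·tⁱ) < v(p)` when
`v(t) ≤ 1`. [cite: Kuhlmann2019, Lemma 3.1 c) and Lemma 4.3 (proof)] -/
theorem exists_delta_chain {b : Ω} (hbF : b ∈ F) (hb : V.valuation b ≤ V.valuation C) {t : Ω}
    (htF : t ∈ F) (i m : ℕ) {a : Ω} (haK : a ∈ K)
    (hsmall : V.valuation (a * t ^ (i * p ^ m)) < V.valuation (p : Ω)) :
    (∃ w ∈ F, w ≠ 0 ∧ 1 + b + a * t ^ (i * p ^ m) =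
      (1 + b + (fun x : Ω => -(p : Ω) * rt x)^[m] a * t ^ i) * w ^ p) ∧
      V.valuation ((fun x : Ω => -(p : Ω) * rt x)^[m] a * t ^ i) < V.valuation (p : Ω) := by
  have hpr : p.Prime := hp.out
  have hpF : (p : Ω) ∈ F := natCast_mem F p
  have hvp0 : 0 < V.valuation (p : Ω) := (Valuation.pos_iff _).mpr hp0
  induction m generalizing a with
  | zero => exact ⟨⟨1, F.one_mem, one_ne_zero, by simp⟩, by simpa using hsmall⟩
  | succ m ih =>
    -- first step: `a t^{i p^{m+1}} = c'^p`, `c' = a^{1/p} t^{i p^m}`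
    set c' : Ω := rt a * t ^ (i * p ^ m) with hc'
    have hc'F : c' ∈ F := mul_mem (hKF (hrtK a haK)) (pow_mem htF _)
    have hc'p : c' ^ p = a * t ^ (i * p ^ (m + 1)) := by
      rw [hc', mul_pow, hrt, ← pow_mul, pow_succ, mul_assoc]
    have hvc' : V.valuation c' ^ p < V.valuation (p : Ω) := by rw [← map_pow, hc'p]; exact hsmall
    obtain ⟨w₁, hw₁F, hw₁0, hw₁⟩ :=
      exists_sub_mul_eq_mul_pow V hF hpr (hKF hCK) hC hp0 hvp hbF hc'F hb hvc'
    -- the new monomial `Δ(a) t^{i p^m} = -p c'` and its smallness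
    have hΔc' : -(p : Ω) * rt a * t ^ (i * p ^ m) = -(p : Ω) * c' := by rw [hc', mul_assoc]
    have hsmall' : V.valuation (-(p : Ω) * rt a * t ^ (i * p ^ m)) < V.valuation (p : Ω) := by
      have h2 : V.valuation (-(p : Ω) * rt a * t ^ (i * p ^ m)) ^ p < V.valuation (p : Ω) ^ p := by
        rw [hΔc', map_mul, Valuation.map_neg, mul_pow]
        calc V.valuation (p : Ω) ^ p * V.valuation c' ^ p < V.valuation (p : Ω) ^ p * 1 :=
              mul_lt_mul_of_pos_left (hvc'.trans hvp) (pow_pos hvp0 p)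
          _ = V.valuation (p : Ω) ^ p := mul_one _
      exact lt_of_pow_lt_pow_left₀ p zero_le h2
    obtain ⟨⟨w₂, hw₂F, hw₂0, hw₂⟩, hfin⟩ :=
      ih (a := -(p : Ω) * rt a) (mul_mem (neg_mem (natCast_mem K p)) (hrtK a haK)) hsmall'
    have hiter : (fun x : Ω => -(p : Ω) * rt x)^[m + 1] a =
        (fun x : Ω => -(p : Ω) * rt x)^[m] (-(p : Ω) * rt a) := by
      rw [Function.iterate_succ_apply]
    refine ⟨⟨w₂ / w₁, div_mem hw₂F hw₁F, div_ne_zero hw₂0 hw₁0, ?_⟩, ?_⟩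
    · -- `1 + b + c'^p = (1 + b - p c') w₁^{-p} = (1 + b + Δ a t^{i p^m}) w₁^{-p} = …`
      rw [← hc'p, hiter, div_pow,
        show (1 + b + (fun x : Ω => -(p : Ω) * rt x)^[m] (-(p : Ω) * rt a) * t ^ i) * (w₂ ^ p / w₁ ^ p) =
          ((1 + b + (fun x : Ω => -(p : Ω) * rt x)^[m] (-(p : Ω) * rt a) * t ^ i) * w₂ ^ p) / w₁ ^ p by ring,
        ← hw₂, hΔc', show 1 + b + -(p : Ω) * c' = 1 + b - p * c' by ring, hw₁,
        mul_div_assoc, div_self (pow_ne_zero _ hw₁0), mul_one]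
    · rw [hiter]; exact hfin

end Chains

/-! ### Generic bookkeeping for the cascade -/

/-- `j = (j / p^{ν_p(j)})·p^{ν_p(j)}`. [folklore] -/
theorem ordCompl_mul_ordProj (p j : ℕ) : j / p ^ j.factorization p * p ^ j.factorization p = j :=
  Nat.div_mul_cancel (Nat.ordProj_dvd j p)

/-- `Δ^{-e}` is a monomial map: `Δ^{-e}(d) = κ_e·d^{p^e}` with `κ_e ∈ K`. [folklore] -/
theorem exists_theta_iterate_eq_mul_pow (K : Subfield Ω) (p e : ℕ) :
    ∃ κ : Ω, κ ∈ K ∧ ∀ d : Ω, (fun x : Ω => (-x / p) ^ p)^[e] d = κ * d ^ (p ^ e) := by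
  induction e with
  | zero => exact ⟨1, K.one_mem, fun d => by simp⟩
  | succ e ih =>
    obtain ⟨κ, hκK, hκ⟩ := ih
    refine ⟨(-κ / p) ^ p, pow_mem (div_mem (neg_mem hκK) (natCast_mem K p)) p, fun d => ?_⟩
    rw [Function.iterate_succ_apply', hκ, pow_succ, pow_mul]
    ring

/-- `p + … + p^{m+e} = (p + … + p^e) + p^e·(p + … + p^m)`. [folklore] -/
theorem sum_range_pow_succ_add (p m e : ℕ) :
    ∑ k ∈ range (m + e), p ^ (k + 1) = ∑ k ∈ range e, p ^ (k + 1) + p ^ e * ∑ k ∈ range m, p ^ (k + 1) := by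
  rw [add_comm m e, sum_range_add, mul_sum]
  congr 1
  refine sum_congr rfl fun k _ => ?_
  ring

/-- `Δ^m(0) = 0` for a root function with `rt(0)^p = 0`. [folklore] -/
theorem delta_iterate_zero {p : ℕ} (hp : p ≠ 0) {rt : Ω → Ω} (hrt : ∀ a, rt a ^ p = a) (m : ℕ) :
    (fun x : Ω => -(p : Ω) * rt x)^[m] 0 = 0 := by
  have h0 : rt 0 = 0 := pow_eq_zero_iff hp |>.mp (hrt 0)
  induction m with
  | zero => rfl
  | succ m ih => rw [Function.iterate_succ_apply', ih]; simp [h0]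

/-- `Δ^m` maps `K` to `K`. [folklore] -/
theorem delta_iterate_mem {K : Subfield Ω} {p : ℕ} {rt : Ω → Ω} (hrtK : ∀ a ∈ K, rt a ∈ K) (m : ℕ)
    {a : Ω} (ha : a ∈ K) : (fun x : Ω => -(p : Ω) * rt x)^[m] a ∈ K := by
  induction m with
  | zero => exact ha
  | succ m ih =>
    rw [Function.iterate_succ_apply']
    exact mul_mem (neg_mem (natCast_mem K p)) (hrtK _ ih)

/-- The value of `Δ^m(a)` depends only on `v(a)`. [folklore] -/
theorem valuation_delta_iterate_congr {p : ℕ} (hp : p.Prime) {rt : Ω → Ω} (hrt : ∀ a, rt a ^ p = a)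
    (m : ℕ) {a a' : Ω} (h : V.valuation a = V.valuation a') :
    V.valuation ((fun x : Ω => -(p : Ω) * rt x)^[m] a) = V.valuation ((fun x : Ω => -(p : Ω) * rt x)^[m] a') := by
  apply pow_injective_val V (pow_ne_zero m hp.ne_zero)
  rw [valuation_delta_iterate_pow V hrt, valuation_delta_iterate_pow V hrt, h]

/-- **Sums with termwise equal, pairwise distinct values have equal value.** [folklore] -/
theorem valuation_sum_eq_of_termwise {ι : Type*} [DecidableEq ι] (s : Finset ι) (u u' : ι → Ω)
    (heq : ∀ i ∈ s, V.valuation (u i) = V.valuation (u' i))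
    (hne : ∀ i ∈ s, ∀ j ∈ s, i ≠ j → u i ≠ 0 → u j ≠ 0 → V.valuation (u i) ≠ V.valuation (u j)) :
    V.valuation (∑ i ∈ s, u i) = V.valuation (∑ i ∈ s, u' i) := by
  have hzero : ∀ i ∈ s, u i = 0 ↔ u' i = 0 := fun i hi => by
    rw [← map_eq_zero V.valuation, heq i hi, map_eq_zero]
  have hne' : ∀ i ∈ s, ∀ j ∈ s, i ≠ j → u' i ≠ 0 → u' j ≠ 0 → V.valuation (u' i) ≠ V.valuation (u' j) :=
    fun i hi j hj hij hi0 hj0 => by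
      rw [← heq i hi, ← heq j hj]
      exact hne i hi j hj hij (fun h => hi0 ((hzero i hi).mp h)) (fun h => hj0 ((hzero j hj).mp h))
  obtain ⟨hle, hmax⟩ := valuation_le_valuation_sum_of_pairwise_ne V s u hne
  obtain ⟨hle', hmax'⟩ := valuation_le_valuation_sum_of_pairwise_ne V s u' hne'
  apply le_antisymm
  · by_cases h0 : ∑ i ∈ s, u i = 0
    · rw [h0, map_zero]; exact zero_le
    · obtain ⟨i, hi, -, hvi⟩ := hmax h0
      rw [hvi, heq i hi]; exact hle' i hi
  · by_cases h0 : ∑ i ∈ s, u' i = 0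
    · rw [h0, map_zero]; exact zero_le
    · obtain ⟨i, hi, -, hvi⟩ := hmax' h0
      rw [hvi, ← heq i hi]; exact hle i hi

/-! ### The merge step -/

section Cascade

variable {p : ℕ} [hp : Fact p.Prime] {K F : Subfield Ω} (hKF : K ≤ F)
  (hF : IsHenselianField F (V.comap (algebraMap F Ω)))
  {C : Ω} (hCK : C ∈ K) (hC : C ^ (p - 1) = -(p : Ω)) (hp0 : (p : Ω) ≠ 0)
  (hvp : V.valuation (p : Ω) < 1) {y : Ω} (hyF : y ∈ F) {g₀ : Ω}
include hKF hF hCK hC hp0 hvp hyF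

/-- **The merge step** (Kuhlmann 2019, proof of Lemma 4.3, second case: "`Δ^{-1}` can be
applied `ℓ − m` many times in order to replace the summand `h_{ip^m}(c)(y−c)^{ip^m}` by
`Δ^{m−ℓ}(1)·h_{ip^m}(c)^{p^{ℓ−m}}(y−c)^{ip^ℓ}` … the new polynomial `h̃*` has less monomials than
`h*`"). Given an admissible family `(h_j)_{j ≤ N}` beyond the threshold `T` — i.e.
`1 + g₀ ∈ (1 + ∑_j h_j(c)(y−c)^j)·(F^×)^p` and all `h_j(c)(y−c)^j` of value `< v(p)` for all
centres `c` beyond `T` —, indices `M ≥ 1`, `e ≥ 1` with `L = Mp^e ≤ N`, `h_M ≠ 0 ≠ h_L`, such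
that beyond `T` the value of `Δ^{-e}(h_M(c)(y−c)^M)` is that of `h_L(c)(y−c)^L`, the family
`h'` with `h'_M = 0`, `h'_L = κ_e h_M^{p^e} + h_L` and `h'_j = h_j` otherwise is admissible
beyond `T`, over `K`, and has fewer non-zero members of positive index.
[cite: Kuhlmann2019, Lemma 4.3 (proof, second case)] -/
theorem merge_step [DecidableEq (Polynomial Ω)] (h : ℕ → Polynomial Ω) (N : ℕ) (hhK : ∀ j n, (h j).coeff n ∈ K)
    {T : Ω}
    (hadm : ∀ c ∈ K, V.valuation (y - c) ≤ V.valuation (y - T) →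
      (∃ w ∈ F, w ≠ 0 ∧ 1 + g₀ = (1 + ∑ j ∈ range (N + 1), (h j).eval c * (y - c) ^ j) * w ^ p) ∧
      ∀ j ∈ range (N + 1), V.valuation ((h j).eval c * (y - c) ^ j) < V.valuation (p : Ω))
    {M e : ℕ} (hM : 1 ≤ M) (he : 1 ≤ e) (hL : M * p ^ e ≤ N) (hM0 : h M ≠ 0) (hL0 : h (M * p ^ e) ≠ 0)
    (hcoinc : ∀ c ∈ K, V.valuation (y - c) ≤ V.valuation (y - T) →
      V.valuation ((fun x : Ω => (-x / p) ^ p)^[e] ((h M).eval c * (y - c) ^ M)) =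
        V.valuation ((h (M * p ^ e)).eval c * (y - c) ^ (M * p ^ e))) :
    ∃ h' : ℕ → Polynomial Ω, (∀ j n, (h' j).coeff n ∈ K) ∧
      (∀ c ∈ K, V.valuation (y - c) ≤ V.valuation (y - T) →
        (∃ w ∈ F, w ≠ 0 ∧ 1 + g₀ = (1 + ∑ j ∈ range (N + 1), (h' j).eval c * (y - c) ^ j) * w ^ p) ∧
        ∀ j ∈ range (N + 1), V.valuation ((h' j).eval c * (y - c) ^ j) < V.valuation (p : Ω)) ∧
      (range (N + 1)).filter (fun j => 1 ≤ j ∧ h' j ≠ 0) ⊂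
        (range (N + 1)).filter (fun j => 1 ≤ j ∧ h j ≠ 0) := by
  classical
  have hpr : p.Prime := hp.out
  have hvp0 : 0 < V.valuation (p : Ω) := (Valuation.pos_iff _).mpr hp0
  have hpC : V.valuation (p : Ω) ≤ V.valuation C := valuation_p_le_valuation_C V hpr hC hvp
  obtain ⟨L, hLdef⟩ : ∃ L, L = M * p ^ e := ⟨_, rfl⟩
  rw [← hLdef] at hL hL0 hcoinc
  set θ : Ω → Ω := fun x => (-x / p) ^ p with hθ
  have hMltL : M < L := by
    have h1 : M * 1 < M * p ^ e :=
      Nat.mul_lt_mul_of_pos_left (Nat.one_lt_pow (by omega) hpr.one_lt) (by omega)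
    rw [mul_one] at h1
    omega
  have hML : M ≠ L := hMltL.ne
  have hMr : M ∈ range (N + 1) := mem_range.mpr (by omega)
  have hLr : L ∈ range (N + 1) := mem_range.mpr (by omega)
  obtain ⟨κ, hκK, hκ⟩ := exists_theta_iterate_eq_mul_pow K p e
  set Θ : Polynomial Ω := Polynomial.C κ * (h M) ^ (p ^ e) with hΘ
  have hΘK : ∀ n, Θ.coeff n ∈ K := forall_coeff_mul_mem (forall_coeff_C_mem hκK) (forall_coeff_pow_mem (hhK M) _)
  have hΘeval : ∀ c : Ω, Θ.eval c * (y - c) ^ L = θ^[e] ((h M).eval c * (y - c) ^ M) := by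
    intro c
    rw [hκ, hΘ, eval_mul, eval_C, eval_pow, hLdef, pow_mul, mul_pow]
    ring
  -- the new family
  set h' : ℕ → Polynomial Ω := fun j => if j = M then 0 else if j = L then Θ + h L else h j with hh'
  have h'M : h' M = 0 := by rw [hh']; simp
  have h'L : h' L = Θ + h L := by rw [hh']; simp [Ne.symm hML]
  have h'j : ∀ j, j ≠ M → j ≠ L → h' j = h j := fun j hjM hjL => by rw [hh']; simp [hjM, hjL]
  refine ⟨h', ?_, ?_, ?_⟩
  · intro j n
    by_cases hjM : j = M
    · rw [hjM, h'M, coeff_zero]; exact K.zero_mem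
    by_cases hjL : j = L
    · rw [hjL, h'L, coeff_add]; exact add_mem (hΘK n) (hhK L n)
    · rw [h'j j hjM hjL]; exact hhK j n
  · intro c hcK hle
    obtain ⟨⟨w, hwF, hw0, hw⟩, htiny⟩ := hadm c hcK hle
    -- splitting the two radicands at `M` and `L`
    set mono : ℕ → Ω := fun j => (h j).eval c * (y - c) ^ j with hmono
    set mono' : ℕ → Ω := fun j => (h' j).eval c * (y - c) ^ j with hmono'
    set rest : Ω := ∑ j ∈ ((range (N + 1)).erase M).erase L, mono j with hrest
    have hLr' : L ∈ (range (N + 1)).erase M := mem_erase.mpr ⟨Ne.symm hML, hLr⟩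
    have hsplit : ∑ j ∈ range (N + 1), mono j = mono M + mono L + rest := by
      rw [← add_sum_erase _ _ hMr, ← add_sum_erase _ _ hLr', add_assoc]
    have hsplit' : ∑ j ∈ range (N + 1), mono' j = θ^[e] (mono M) + mono L + rest := by
      rw [← add_sum_erase _ _ hMr, ← add_sum_erase _ _ hLr']
      have h1 : mono' M = 0 := by rw [hmono']; simp [h'M]
      have h2 : mono' L = θ^[e] (mono M) + mono L := by
        rw [hmono']; simp only [h'L, eval_add, add_mul, hΘeval]; rfl
      have h3 : ∑ j ∈ ((range (N + 1)).erase M).erase L, mono' j = rest := by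
        refine sum_congr rfl fun j hj => ?_
        rw [mem_erase, mem_erase] at hj
        rw [hmono', hmono]; simp only [h'j j hj.2.1 hj.1]
      rw [h1, h2, h3]; ring
    -- smallness of everything
    have hmonoF : ∀ j, mono j ∈ F := fun j =>
      mul_mem (eval_mem_subfield_of_coeff_mem (fun k => hKF (hhK j k)) (hKF hcK)) (pow_mem (sub_mem hyF (hKF hcK)) j)
    have hrestF : rest ∈ F := sum_mem fun j _ => hmonoF j
    have hrest_lt : V.valuation (mono L + rest) < V.valuation (p : Ω) := by
      refine Valuation.map_add_lt _ (htiny L hLr) (Valuation.map_sum_lt _ hvp0.ne' fun j hj => ?_)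
      rw [mem_erase, mem_erase] at hj
      exact htiny j hj.2.2
    have hb : V.valuation (rest + mono L) ≤ V.valuation C := by
      rw [add_comm]; exact hrest_lt.le.trans hpC
    -- the backward chain on `mono M`
    have hends := valuation_theta_iterate_lt_of_ends V hpr hp0 (β := V.valuation (p : Ω)) (e := e)
      (htiny M hMr) (lt_of_eq_of_lt (hcoinc c hcK hle) (htiny L hLr))
    obtain ⟨w', hw'F, hw'0, hw'⟩ := exists_theta_chain V hKF hF hCK hC hp0 hvp
      (add_mem hrestF (hmonoF L)) hb (hmonoF M) e (fun k _ hke => hends k hke)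
    refine ⟨⟨w' * w, mul_mem hw'F hwF, mul_ne_zero hw'0 hw0, ?_⟩, ?_⟩
    · rw [hw, show (∑ j ∈ range (N + 1), (h j).eval c * (y - c) ^ j) = ∑ j ∈ range (N + 1), mono j from rfl,
        show (∑ j ∈ range (N + 1), (h' j).eval c * (y - c) ^ j) = ∑ j ∈ range (N + 1), mono' j from rfl,
        hsplit, hsplit', show (1 : Ω) + (mono M + mono L + rest) = 1 + (rest + mono L) + mono M by ring, hw',
        mul_pow]
      ring
    · intro j hj
      show V.valuation (mono' j) < V.valuation (p : Ω)
      by_cases hjM : j = M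
      · rw [hjM, hmono']; simp [h'M, hvp0]
      by_cases hjL : j = L
      · rw [hjL, hmono']
        simp only [h'L, eval_add, add_mul, hΘeval]
        exact Valuation.map_add_lt _ (lt_of_eq_of_lt (hcoinc c hcK hle) (htiny L hLr)) (htiny L hLr)
      · rw [hmono']; simp only [h'j j hjM hjL]; exact htiny j hj
  · -- fewer non-zero members
    refine (Finset.ssubset_iff_of_subset ?_).mpr ⟨M, mem_filter.mpr ⟨hMr, hM, hM0⟩, fun hm => ?_⟩
    · intro j hj
      rw [mem_filter] at hj ⊢
      refine ⟨hj.1, hj.2.1, ?_⟩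
      by_cases hjM : j = M
      · exact absurd h'M (hjM ▸ hj.2.2)
      by_cases hjL : j = L
      · rw [hjL]; exact hL0
      · rw [← h'j j hjM hjL]; exact hj.2.2
    · rw [mem_filter] at hm
      exact hm.2.2 h'M

/-! ### The forward transformation at a fixed centre -/

variable {rt : Ω → Ω} (hrt : ∀ a, rt a ^ p = a) (hrtK : ∀ a ∈ K, rt a ∈ K)
include hrt hrtK

/-- **The forward chains at a centre `c`** (Kuhlmann 2019, proof of Lemma 4.3, second case:
"we use part c) of Lemma 3.1 `m` many times to replace this summand by `Δ^m(h_{ip^m}(c)(y−c)^{ip^m})`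
… In this way we turn `h*(y,c)` into a polynomial `h_0(c) + ∑_{p∤i} r_i(c)(y−c)^i`"): if all
`h_j(c)(y−c)^j`, `j ≤ N`, have value `< v(p)`, then for every set `A` of positive indices
`1 + ∑_{j≤N} h_j(c)(y−c)^j ∈ (1 + h_0(c) + ∑_{j∈A} Δ^{ν_p(j)}(h_j(c))·(y−c)^{j/p^{ν_p(j)}} +
∑_{j∉A} h_j(c)(y−c)^j)·(F^×)^p`, all new monomials again of value `< v(p)`.
[cite: Kuhlmann2019, Lemma 4.3 (proof, second case)] -/
theorem forward_chains (h : ℕ → Polynomial Ω) (N : ℕ) (hhK : ∀ j n, (h j).coeff n ∈ K)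
    {c : Ω} (hcK : c ∈ K)
    (htiny : ∀ j ∈ range (N + 1), V.valuation ((h j).eval c * (y - c) ^ j) < V.valuation (p : Ω))
    (A : Finset ℕ) (hA : A ⊆ Ico 1 (N + 1)) :
    (∃ w ∈ F, w ≠ 0 ∧ 1 + ∑ j ∈ range (N + 1), (h j).eval c * (y - c) ^ j =
      (1 + ((h 0).eval c +
        ∑ j ∈ A, (fun x : Ω => -(p : Ω) * rt x)^[j.factorization p] ((h j).eval c) *
          (y - c) ^ (j / p ^ j.factorization p) +
        ∑ j ∈ Ico 1 (N + 1) \ A, (h j).eval c * (y - c) ^ j)) * w ^ p) ∧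
      ∀ j ∈ A, V.valuation ((fun x : Ω => -(p : Ω) * rt x)^[j.factorization p] ((h j).eval c) *
        (y - c) ^ (j / p ^ j.factorization p)) < V.valuation (p : Ω) := by
  classical
  have hpr : p.Prime := hp.out
  have hvp0 : 0 < V.valuation (p : Ω) := (Valuation.pos_iff _).mpr hp0
  have hpC : V.valuation (p : Ω) ≤ V.valuation C := valuation_p_le_valuation_C V hpr hC hvp
  set Δ : Ω → Ω := fun x : Ω => -(p : Ω) * rt x with hΔ
  set mono : ℕ → Ω := fun j => (h j).eval c * (y - c) ^ j with hmono
  set τ : ℕ → Ω := fun j => Δ^[j.factorization p] ((h j).eval c) * (y - c) ^ (j / p ^ j.factorization p)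
    with hτ
  have hycF : y - c ∈ F := sub_mem hyF (hKF hcK)
  have hevalK : ∀ j, (h j).eval c ∈ K := fun j => eval_mem_subfield_of_coeff_mem (hhK j) hcK
  have hmonoF : ∀ j, mono j ∈ F := fun j => mul_mem (hKF (hevalK j)) (pow_mem hycF j)
  have hτF : ∀ j, τ j ∈ F := fun j => mul_mem (hKF (delta_iterate_mem hrtK _ (hevalK j))) (pow_mem hycF _)
  have h0r : (0 : ℕ) ∈ range (N + 1) := mem_range.mpr (Nat.succ_pos N)
  have hmono0 : mono 0 = (h 0).eval c := by rw [hmono]; simp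
  -- the statement, by induction on `A`
  show (∃ w ∈ F, w ≠ 0 ∧ 1 + ∑ j ∈ range (N + 1), mono j =
      (1 + ((h 0).eval c + ∑ j ∈ A, τ j + ∑ j ∈ Ico 1 (N + 1) \ A, mono j)) * w ^ p) ∧
      ∀ j ∈ A, V.valuation (τ j) < V.valuation (p : Ω)
  induction A using Finset.induction_on with
  | empty =>
    refine ⟨⟨1, F.one_mem, one_ne_zero, ?_⟩, fun j hj => absurd hj (Finset.notMem_empty j)⟩
    rw [sum_empty, add_zero, sdiff_empty, one_pow, mul_one, range_eq_Ico,
      sum_eq_sum_Ico_succ_bot (Nat.succ_pos N), hmono0]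
  | insert j A hjA ih =>
    have hjI : j ∈ Ico 1 (N + 1) := hA (mem_insert_self j A)
    have hj1 : 1 ≤ j := (mem_Ico.mp hjI).1
    have hjr : j ∈ range (N + 1) := mem_range.mpr (mem_Ico.mp hjI).2
    obtain ⟨⟨w, hwF, hw0, hw⟩, htinyA⟩ := ih ((subset_insert j A).trans hA)
    -- split off `mono j` from the untransformed part
    have hjmem : j ∈ Ico 1 (N + 1) \ A := mem_sdiff.mpr ⟨hjI, hjA⟩
    have hsd : Ico 1 (N + 1) \ insert j A = (Ico 1 (N + 1) \ A).erase j := by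
      rw [sdiff_insert]
    have hsplit : ∑ k ∈ Ico 1 (N + 1) \ A, mono k = mono j + ∑ k ∈ Ico 1 (N + 1) \ insert j A, mono k := by
      rw [hsd, add_sum_erase _ _ hjmem]
    -- the rest `b`
    set b : Ω := (h 0).eval c + ∑ k ∈ A, τ k + ∑ k ∈ Ico 1 (N + 1) \ insert j A, mono k with hb
    have hbF : b ∈ F := add_mem (add_mem (hKF (hevalK 0)) (sum_mem fun k _ => hτF k))
      (sum_mem fun k _ => hmonoF k)
    have hb_lt : V.valuation b < V.valuation (p : Ω) := by
      refine Valuation.map_add_lt _ (Valuation.map_add_lt _ ?_ ?_) ?_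
      · rw [← hmono0]; exact htiny 0 h0r
      · exact Valuation.map_sum_lt _ hvp0.ne' fun k hk => htinyA k hk
      · refine Valuation.map_sum_lt _ hvp0.ne' fun k hk => ?_
        rw [mem_sdiff, mem_Ico] at hk
        exact htiny k (mem_range.mpr hk.1.2)
    -- the forward chain on `mono j = a t^{i p^m}`
    have hmonoj : mono j = (h j).eval c * (y - c) ^ (j / p ^ j.factorization p * p ^ j.factorization p) := by
      rw [ordCompl_mul_ordProj p j]
    obtain ⟨⟨w', hw'F, hw'0, hw'⟩, hτj⟩ := exists_delta_chain V hKF hF hCK hC hp0 hvp hrt hrtK hbF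
      (hb_lt.le.trans hpC) hycF (j / p ^ j.factorization p) (j.factorization p) (hevalK j)
      (by rw [← hmonoj]; exact htiny j hjr)
    refine ⟨⟨w' * w, mul_mem hw'F hwF, mul_ne_zero hw'0 hw0, ?_⟩, fun k hk => ?_⟩
    · rw [hw, hsplit, sum_insert hjA,
        show (1 : Ω) + ((h 0).eval c + ∑ k ∈ A, τ k + (mono j + ∑ k ∈ Ico 1 (N + 1) \ insert j A, mono k)) =
          1 + b + mono j by rw [hb]; ring, hmonoj, hw', mul_pow,
        show (1 : Ω) + ((h 0).eval c + (τ j + ∑ k ∈ A, τ k) + ∑ k ∈ Ico 1 (N + 1) \ insert j A, mono k) =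
          1 + b + τ j by rw [hb]; ring]
      ring
    · rcases mem_insert.mp hk with rfl | hk
      · exact hτj
      · exact htinyA k hk

/-! ### The terminal step: no coincidences -/

/-- **The terminal step** (Kuhlmann 2019, proof of Lemma 4.3, end of the second case): let
`(h_j)_{j≤N}` be admissible beyond `T`, with the values `vh_j(c) = vh_j(y)` beyond `T`
(Kaplansky), and assume there is NO coincidence
`v(h_M(y))^{p^e} = v(p)^{p+…+p^e}·v(h_{Mp^e}(y))` (`M, e ≥ 1`, `Mp^e ≤ N`, `h_M ≠ 0 ≠ h_{Mp^e}`).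
Then, `1 + g₀` not being a `p`-th power in `F`, there are `c₂ ∈ K`, `0 ≠ b ∈ K` with
`v((y−c₂)/b) = 1` and `G` over `K` with `1 + g₀ ∈ (1 + G((y−c₂)/b))·(F^×)^p` whose coefficients
of positive index are dominated by one of index prime to `p`: after the forward chains the
radicand is `1 + h_0(c) + ∑_{p∤i} r_i(c)(y−c)^i` with `vr_i(c)` independent of `c` (the values
`vΔ^m(h_{ip^m}(c))` being pairwise distinct), and `c₂` is a centre where one monomial
`r_i(c₂)(y−c₂)^i` strictly dominates (`approach_exists_strict_winner`).
[cite: Kuhlmann2019, Lemma 4.3 (proof, second case)] -/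
theorem terminal_step (hyK : y ∉ K)
    (hval : ∀ w ∈ Subfield.closure ((K : Set Ω) ∪ {y}), w ≠ 0 → ∃ b ∈ K,
      V.valuation w = V.valuation b)
    (hres : ∀ w ∈ Subfield.closure ((K : Set Ω) ∪ {y}), w ∈ V → ∃ c ∈ K,
      V.valuation (w - c) < 1)
    (h : ℕ → Polynomial Ω) (N : ℕ) (hhK : ∀ j n, (h j).coeff n ∈ K) {T : Ω} (hTK : T ∈ K)
    (hadm : ∀ c ∈ K, V.valuation (y - c) ≤ V.valuation (y - T) →
      (∃ w ∈ F, w ≠ 0 ∧ 1 + g₀ = (1 + ∑ j ∈ range (N + 1), (h j).eval c * (y - c) ^ j) * w ^ p) ∧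
      ∀ j ∈ range (N + 1), V.valuation ((h j).eval c * (y - c) ^ j) < V.valuation (p : Ω))
    (hkap : ∀ c ∈ K, V.valuation (y - c) ≤ V.valuation (y - T) →
      ∀ j ∈ range (N + 1), h j ≠ 0 → V.valuation ((h j).eval c) = V.valuation ((h j).eval y))
    (hnoc : ∀ M e, 1 ≤ M → 1 ≤ e → M * p ^ e ≤ N → h M ≠ 0 → h (M * p ^ e) ≠ 0 →
      V.valuation ((h M).eval y) ^ (p ^ e) ≠
        V.valuation (p : Ω) ^ (∑ k ∈ range e, p ^ (k + 1)) * V.valuation ((h (M * p ^ e)).eval y))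
    (hnt : ¬ ∃ w ∈ F, w ^ p = 1 + g₀) :
    ∃ c₂ ∈ K, ∃ b ∈ K, b ≠ 0 ∧ V.valuation ((y - c₂) / b) = 1 ∧
      ∃ G : Polynomial Ω, (∀ k, G.coeff k ∈ K) ∧
        (∃ w ∈ F, w ≠ 0 ∧ 1 + g₀ = (1 + G.eval ((y - c₂) / b)) * w ^ p) ∧
        (∃ i₀, 0 < i₀ ∧ ¬ p ∣ i₀ ∧ G.coeff i₀ ≠ 0 ∧
          ∀ i, 0 < i → i ≠ i₀ → V.valuation (G.coeff i) < V.valuation (G.coeff i₀)) := by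
  classical
  have hpr : p.Prime := hp.out
  have hvp0 : 0 < V.valuation (p : Ω) := (Valuation.pos_iff _).mpr hp0
  set Δ : Ω → Ω := fun x : Ω => -(p : Ω) * rt x with hΔ
  set mf : ℕ → ℕ := fun j => j.factorization p with hmf
  set nf : ℕ → ℕ := fun j => j / p ^ j.factorization p with hnf
  set I : Finset ℕ := (Ico 1 (N + 1)).filter (fun i => ¬ p ∣ i) with hI
  -- the transformed coefficients `u c j = Δ^{m_j}(h_j(c))` and `r c i = ∑_{fibre} u c j`
  set u : Ω → ℕ → Ω := fun c j => Δ^[mf j] ((h j).eval c) with hu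
  set r : Ω → ℕ → Ω := fun c i => ∑ j ∈ (Ico 1 (N + 1)).filter (fun j => nf j = i), u c j with hr
  have hevalK : ∀ c ∈ K, ∀ j, (h j).eval c ∈ K := fun c hc j => eval_mem_subfield_of_coeff_mem (hhK j) hc
  have huK : ∀ c ∈ K, ∀ j, u c j ∈ K := fun c hc j => delta_iterate_mem hrtK _ (hevalK c hc j)
  have hrK : ∀ c ∈ K, ∀ i, r c i ∈ K := fun c hc i => sum_mem fun j _ => huK c hc j
  /- facts about `nf`, `mf` -/
  have hnm : ∀ j, nf j * p ^ mf j = j := fun j => ordCompl_mul_ordProj p j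
  have hnf_ndvd : ∀ j, 1 ≤ j → ¬ p ∣ nf j := fun j hj => Nat.not_dvd_ordCompl hpr (by omega)
  have hnfI : ∀ j ∈ Ico 1 (N + 1), nf j ∈ I := by
    intro j hj
    rw [mem_Ico] at hj
    have h1 := hnm j
    have hpos : 0 < p ^ mf j := pow_pos hpr.pos _
    have hnf1 : 1 ≤ nf j := by
      by_contra h0; push Not at h0
      have : nf j = 0 := by omega
      rw [this, zero_mul] at h1; omega
    have hnfle : nf j ≤ j := by
      calc nf j = nf j * 1 := (mul_one _).symm
        _ ≤ nf j * p ^ mf j := Nat.mul_le_mul_left _ hpos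
        _ = j := h1
    rw [hI, mem_filter, mem_Ico]
    exact ⟨⟨hnf1, by omega⟩, hnf_ndvd j hj.1⟩
  -- two indices in the same fibre with the same `p`-adic order are equal; otherwise `j' = j p^e`
  have hfib : ∀ j j', nf j = nf j' → mf j < mf j' → j' = j * p ^ (mf j' - mf j) := by
    intro j j' hn hm
    calc j' = nf j' * p ^ mf j' := (hnm j').symm
      _ = nf j * (p ^ mf j * p ^ (mf j' - mf j)) := by rw [hn, ← pow_add, Nat.add_sub_cancel' hm.le]
      _ = j * p ^ (mf j' - mf j) := by rw [← mul_assoc, hnm j]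
  have hfib_eq : ∀ j j', nf j = nf j' → mf j = mf j' → j = j' := by
    intro j j' hn hm
    rw [← hnm j, ← hnm j', hn, hm]
  /- Step 1: the radicand after the forward chains, beyond `T` -/
  have hforward : ∀ c ∈ K, V.valuation (y - c) ≤ V.valuation (y - T) →
      ∃ w ∈ F, w ≠ 0 ∧ 1 + g₀ = (1 + ((h 0).eval c + ∑ i ∈ I, r c i * (y - c) ^ i)) * w ^ p := by
    intro c hcK hle
    obtain ⟨⟨w₀, hw₀F, hw₀0, hw₀⟩, htiny⟩ := hadm c hcK hle
    obtain ⟨⟨w, hwF, hw0, hw⟩, -⟩ := forward_chains V hKF hF hCK hC hp0 hvp hyF hrt hrtK h N hhK hcK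
      htiny (Ico 1 (N + 1)) subset_rfl
    rw [sdiff_self, Finset.bot_eq_empty, sum_empty, add_zero] at hw
    -- regroup the transformed monomials by fibres
    have hregroup : ∑ j ∈ Ico 1 (N + 1), Δ^[j.factorization p] ((h j).eval c) *
        (y - c) ^ (j / p ^ j.factorization p) = ∑ i ∈ I, r c i * (y - c) ^ i := by
      rw [← sum_fiberwise_of_maps_to hnfI]
      refine sum_congr rfl fun i _ => ?_
      rw [hr]
      simp only [sum_mul]
      refine sum_congr rfl fun j hj => ?_
      rw [mem_filter] at hj
      rw [← hj.2]
    refine ⟨w * w₀, mul_mem hwF hw₀F, mul_ne_zero hw0 hw₀0, ?_⟩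
    rw [hw₀, hw, hregroup, mul_pow]
    ring
  /- Step 2: the values `v(u c j)` and `v(r c i)` do not depend on `c` beyond `T` -/
  have hu_const : ∀ c ∈ K, V.valuation (y - c) ≤ V.valuation (y - T) →
      ∀ j ∈ range (N + 1), V.valuation (u c j) = V.valuation (u T j) := by
    intro c hcK hle j hj
    by_cases hj0 : h j = 0
    · rw [hu]; simp [hj0]
    · exact valuation_delta_iterate_congr V hpr hrt _
        ((hkap c hcK hle j hj hj0).trans (hkap T hTK le_rfl j hj hj0).symm)
  have hu_zero : ∀ c j, h j = 0 → u c j = 0 := fun c j hj0 => by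
    rw [hu]; simp only [hj0, eval_zero]; exact delta_iterate_zero hpr.ne_zero hrt _
  -- pairwise distinct values in a fibre (no coincidence)
  have hdistinct : ∀ c ∈ K, V.valuation (y - c) ≤ V.valuation (y - T) →
      ∀ j ∈ Ico 1 (N + 1), ∀ j' ∈ Ico 1 (N + 1), nf j = nf j' → mf j < mf j' →
      h j ≠ 0 → h j' ≠ 0 → V.valuation (u c j) ≠ V.valuation (u c j') := by
    intro c hcK hle j hj j' hj' hn hm hj0 hj'0 heqv
    set e := mf j' - mf j with he
    have he1 : 1 ≤ e := by omega
    have hjj' : j' = j * p ^ e := hfib j j' hn hm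
    have hmj' : mf j' = mf j + e := by omega
    have hj1 : 1 ≤ j := (mem_Ico.mp hj).1
    have hj'N : j * p ^ e ≤ N := by rw [← hjj']; have := (mem_Ico.mp hj').2; omega
    -- the values of `a = h_j(c)`, `a' = h_{j'}(c)`
    set a := (h j).eval c with ha
    set a' := (h j').eval c with ha'
    have hva : V.valuation a = V.valuation ((h j).eval y) :=
      hkap c hcK hle j (mem_range.mpr (mem_Ico.mp hj).2) hj0
    have hva' : V.valuation a' = V.valuation ((h (j * p ^ e)).eval y) := by
      rw [← hjj']; exact hkap c hcK hle j' (mem_range.mpr (mem_Ico.mp hj').2) hj'0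
    -- `v(u c j)^{p^{m}} = v(p)^{S m} v(a)`, `v(u c j')^{p^{m+e}} = v(p)^{S(m+e)} v(a')`
    have E1 : V.valuation (u c j) ^ (p ^ mf j) = V.valuation (p : Ω) ^ (∑ k ∈ range (mf j), p ^ (k + 1)) *
        V.valuation a := valuation_delta_iterate_pow V hrt _ _
    have E2 : V.valuation (u c j') ^ (p ^ (mf j + e)) =
        V.valuation (p : Ω) ^ (∑ k ∈ range (mf j + e), p ^ (k + 1)) * V.valuation a' := by
      rw [← hmj']; exact valuation_delta_iterate_pow V hrt _ _
    have E3 : V.valuation (u c j) ^ (p ^ (mf j + e)) = V.valuation (u c j') ^ (p ^ (mf j + e)) := by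
      rw [heqv]
    rw [E2] at E3
    rw [pow_add p (mf j) e, pow_mul, E1, sum_range_pow_succ_add,
      pow_add (V.valuation (p : Ω)) (∑ k ∈ range e, p ^ (k + 1)) (p ^ e * ∑ k ∈ range (mf j), p ^ (k + 1)),
      mul_pow, ← pow_mul, mul_comm (∑ k ∈ range (mf j), p ^ (k + 1)) (p ^ e)] at E3
    -- cancel `v(p)^{p^e S m}`
    have hne0 : V.valuation (p : Ω) ^ (p ^ e * ∑ k ∈ range (mf j), p ^ (k + 1)) ≠ 0 :=
      pow_ne_zero _ hvp0.ne'
    have E4 : V.valuation a ^ p ^ e = V.valuation (p : Ω) ^ (∑ k ∈ range e, p ^ (k + 1)) * V.valuation a' := by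
      apply mul_left_cancel₀ hne0
      rw [E3]; ac_rfl
    rw [hva, hva'] at E4
    exact hnoc j e hj1 he1 hj'N hj0 (hjj' ▸ hj'0) E4
  have hr_const : ∀ c ∈ K, V.valuation (y - c) ≤ V.valuation (y - T) →
      ∀ i ∈ I, V.valuation (r c i) = V.valuation (r T i) := by
    intro c hcK hle i _
    rw [hr]
    refine valuation_sum_eq_of_termwise V _ (u c) (u T) (fun j hj => ?_) (fun j hj j' hj' hjj' hj0 hj'0 => ?_)
    · rw [mem_filter, mem_Ico] at hj
      exact hu_const c hcK hle j (mem_range.mpr hj.1.2)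
    · rw [mem_filter] at hj hj'
      have hhj : h j ≠ 0 := fun h0 => hj0 (hu_zero c j h0)
      have hhj' : h j' ≠ 0 := fun h0 => hj'0 (hu_zero c j' h0)
      have hn : nf j = nf j' := hj.2.trans hj'.2.symm
      rcases lt_trichotomy (mf j) (mf j') with hlt | heq | hgt
      · exact hdistinct c hcK hle j hj.1 j' hj'.1 hn hlt hhj hhj'
      · exact absurd (hfib_eq j j' hn heq) hjj'
      · exact (hdistinct c hcK hle j' hj'.1 j hj.1 hn.symm hgt hhj' hhj).symm
  /- Step 3: some `r T i` is non-zero -/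
  have hex : ∃ i₁ ∈ I, r T i₁ ≠ 0 := by
    by_contra hall
    push Not at hall
    obtain ⟨w, hwF, hw0, hw⟩ := hforward T hTK le_rfl
    have hsum0 : ∑ i ∈ I, r T i * (y - T) ^ i = 0 := sum_eq_zero fun i hi => by rw [hall i hi, zero_mul]
    rw [hsum0, add_zero] at hw
    -- `1 + h_0(T) ∈ K` is a `p`-th power
    have h1K : 1 + (h 0).eval T ∈ K := add_mem K.one_mem (hevalK T hTK 0)
    refine hnt ⟨rt (1 + (h 0).eval T) * w, mul_mem (hKF (hrtK _ h1K)) hwF, ?_⟩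
    rw [mul_pow, hrt, hw]
  obtain ⟨i₁, hi₁I, hi₁⟩ := hex
  /- Step 4: the eventual strict winner among `v(r_i)·v(y - c)^i` -/
  obtain ⟨i₀, hi₀I, hαi₀, TW, hTWK, hwin⟩ := approach_exists_strict_winner V K hyK hval hres
    (fun i => V.valuation (r T i)) I hi₁I ((Valuation.ne_zero_iff _).mpr hi₁) hTK
  obtain ⟨c₂, hc₂K, hc₂⟩ := approach_eventually_and V K
    (P := fun a => V.valuation (y - a) ≤ V.valuation (y - T)) ⟨T, hTK, fun a _ hle => hle⟩ ⟨TW, hTWK, hwin⟩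
  obtain ⟨hle₂, hwin₂⟩ := hc₂ c₂ hc₂K le_rfl
  /- Step 5: the data `b`, `z̃ = (y - c₂)/b`, `G` -/
  have hyc0 : y - c₂ ≠ 0 := sub_ne_zero.mpr fun h0 => hyK (h0 ▸ hc₂K)
  obtain ⟨b, hbK, hyb⟩ := hval (y - c₂) (sub_mem (Subfield.subset_closure (Or.inr rfl))
    (Subfield.subset_closure (Or.inl hc₂K))) hyc0
  have hb0 : b ≠ 0 := fun h0 => by rw [h0, map_zero] at hyb; exact hyc0 ((_root_.map_eq_zero _).mp hyb)
  have hvb0 : V.valuation b ≠ 0 := (_root_.map_ne_zero _).mpr hb0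
  have hγ0 : V.valuation (y - c₂) ≠ 0 := (_root_.map_ne_zero _).mpr hyc0
  set zt : Ω := (y - c₂) / b with hzt
  have hzt1 : V.valuation zt = 1 := by rw [hzt, map_div₀, hyb, div_self hvb0]
  have hbzt : b * zt = y - c₂ := by rw [hzt, mul_div_cancel₀ _ hb0]
  set G : Polynomial Ω := Polynomial.C ((h 0).eval c₂) + ∑ i ∈ I, Polynomial.C (r c₂ i * b ^ i) * X ^ i with hG
  have hGK : ∀ k, G.coeff k ∈ K := forall_coeff_add_mem (forall_coeff_C_mem (hevalK c₂ hc₂K 0))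
    (forall_coeff_sum_mem I fun i _ => forall_coeff_C_mul_X_pow_mem (mul_mem (hrK c₂ hc₂K i) (pow_mem hbK i)) i)
  have hI0 : (0 : ℕ) ∉ I := by rw [hI, mem_filter, mem_Ico]; omega
  have hGcoeff : ∀ n, 1 ≤ n → G.coeff n = if n ∈ I then r c₂ n * b ^ n else 0 := by
    intro n hn
    rw [hG, coeff_add, coeff_C, if_neg (by omega), zero_add, finsetSum_coeff]
    simp only [coeff_C_mul_X_pow]
    rw [sum_ite_eq I n]
  have hGeval : G.eval zt = (h 0).eval c₂ + ∑ i ∈ I, r c₂ i * (y - c₂) ^ i := by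
    rw [hG, eval_add, eval_C, eval_finsetSum]
    congr 1
    refine sum_congr rfl fun i _ => ?_
    simp only [eval_mul, eval_C, eval_pow, eval_X]
    rw [mul_assoc, ← mul_pow, hbzt]
  -- values of the coefficients of `G`
  have hvG : ∀ i ∈ I, V.valuation (G.coeff i) = V.valuation (r T i) * V.valuation (y - c₂) ^ i := by
    intro i hi
    have hi1 : 1 ≤ i := by rw [hI, mem_filter, mem_Ico] at hi; exact hi.1.1
    rw [hGcoeff i hi1, if_pos hi, map_mul, map_pow, hr_const c₂ hc₂K hle₂ i hi, hyb]
  have hvG0 : V.valuation (G.coeff i₀) ≠ 0 := by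
    rw [hvG i₀ hi₀I]; exact mul_ne_zero hαi₀ (pow_ne_zero _ hγ0)
  obtain ⟨w, hwF, hw0, hw⟩ := hforward c₂ hc₂K hle₂
  have hi₀' : 0 < i₀ ∧ ¬ p ∣ i₀ := by
    rw [hI, mem_filter, mem_Ico] at hi₀I; exact ⟨hi₀I.1.1, hi₀I.2⟩
  refine ⟨c₂, hc₂K, b, hbK, hb0, hzt1, G, hGK, ⟨w, hwF, hw0, by rw [hGeval]; exact hw⟩,
    i₀, hi₀'.1, hi₀'.2, (Valuation.ne_zero_iff _).mp hvG0, fun i hi hii₀ => ?_⟩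
  by_cases hiI : i ∈ I
  · rw [hvG i hiI, hvG i₀ hi₀I]
    exact hwin₂ i hiI hii₀
  · rw [hGcoeff i hi, if_neg hiI, map_zero]
    exact zero_lt_iff.mpr hvG0

/-! ### The cascade: induction on the number of non-zero coefficient polynomials -/

/-- **The cascade** (Kuhlmann 2019, proof of Lemma 4.3, second case, Ershov's
minimal-counterexample argument as an induction): for an admissible family `(h_j)_{j≤N}` over
`K` beyond some threshold, the conclusion of `(H43)` holds for the radicand `1 + g₀`
(`y ∉ K` of transcendental approximation type with `(K(y)|K, v)` immediate, `1 + g₀` not a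
`p`-th power in `F`): take the Kaplansky threshold for the `h_j`; if there is a coincidence,
`merge_step` lowers the number of non-zero `h_j`, `j ≥ 1`; otherwise `terminal_step` applies.
[cite: Kuhlmann2019, Lemma 4.3 (proof, second case)] -/
theorem cascade [DecidableEq (Polynomial Ω)] (hyK : y ∉ K)
    (htrans : ∀ P : Polynomial Ω, (∀ k, P.coeff k ∈ K) → P.eval y = 0 → P = 0)
    (hval : ∀ w ∈ Subfield.closure ((K : Set Ω) ∪ {y}), w ≠ 0 → ∃ b ∈ K,
      V.valuation w = V.valuation b)
    (hres : ∀ w ∈ Subfield.closure ((K : Set Ω) ∪ {y}), w ∈ V → ∃ c ∈ K,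
      V.valuation (w - c) < 1)
    (h3 : ∀ g : Polynomial Ω, (∀ k, g.coeff k ∈ K) → ∃ a₀ ∈ K, ∃ α : V.ValueGroup,
      ∀ a ∈ K, V.valuation (y - a) ≤ V.valuation (y - a₀) → V.valuation (g.eval a) = α)
    (hnt : ¬ ∃ w ∈ F, w ^ p = 1 + g₀) (N : ℕ) (n : ℕ) :
    ∀ (h : ℕ → Polynomial Ω) (T : Ω), (∀ j k, (h j).coeff k ∈ K) → T ∈ K →
      (∀ c ∈ K, V.valuation (y - c) ≤ V.valuation (y - T) →
        (∃ w ∈ F, w ≠ 0 ∧ 1 + g₀ = (1 + ∑ j ∈ range (N + 1), (h j).eval c * (y - c) ^ j) * w ^ p) ∧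
        ∀ j ∈ range (N + 1), V.valuation ((h j).eval c * (y - c) ^ j) < V.valuation (p : Ω)) →
      ((range (N + 1)).filter (fun j => 1 ≤ j ∧ h j ≠ 0)).card = n →
    ∃ c₂ ∈ K, ∃ b ∈ K, b ≠ 0 ∧ V.valuation ((y - c₂) / b) = 1 ∧
      ∃ G : Polynomial Ω, (∀ k, G.coeff k ∈ K) ∧
        (∃ w ∈ F, w ≠ 0 ∧ 1 + g₀ = (1 + G.eval ((y - c₂) / b)) * w ^ p) ∧
        (∃ i₀, 0 < i₀ ∧ ¬ p ∣ i₀ ∧ G.coeff i₀ ≠ 0 ∧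
          ∀ i, 0 < i → i ≠ i₀ → V.valuation (G.coeff i) < V.valuation (G.coeff i₀)) := by
  have hpr : p.Prime := hp.out
  have hvp0 : 0 < V.valuation (p : Ω) := (Valuation.pos_iff _).mpr hp0
  induction n using Nat.strong_induction_on with
  | _ n ih =>
  intro h T hhK hTK hadm hcard
  /- Kaplansky threshold for the non-zero `h_j`, `j ≤ N`, combined with `T` -/
  have hkapj : ∀ j ∈ range (N + 1), ∃ a₀ ∈ K, ∀ a ∈ K, V.valuation (y - a) ≤ V.valuation (y - a₀) →
      (h j ≠ 0 → V.valuation ((h j).eval a) = V.valuation ((h j).eval y)) := by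
    intro j _
    by_cases hj0 : h j = 0
    · exact ⟨T, hTK, fun a _ _ hne => absurd hj0 hne⟩
    · have hjy : (h j).eval y ≠ 0 := fun h0 => hj0 (htrans _ (hhK j) h0)
      obtain ⟨a₀, ha₀, hk⟩ := approach_valuation_eval_eq V K hyK hval hres h3 (hhK j) hjy
      exact ⟨a₀, ha₀, fun a ha hle _ => hk a ha hle⟩
  obtain ⟨T₁, hT₁K, hT₁⟩ := approach_eventually_finset V K (range (N + 1)) hTK hkapj
  obtain ⟨T', hT'K, hT'⟩ := approach_eventually_and V K
    (P := fun a => V.valuation (y - a) ≤ V.valuation (y - T)) ⟨T, hTK, fun a _ hle => hle⟩ ⟨T₁, hT₁K, hT₁⟩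
  have hadm' : ∀ c ∈ K, V.valuation (y - c) ≤ V.valuation (y - T') →
      (∃ w ∈ F, w ≠ 0 ∧ 1 + g₀ = (1 + ∑ j ∈ range (N + 1), (h j).eval c * (y - c) ^ j) * w ^ p) ∧
      ∀ j ∈ range (N + 1), V.valuation ((h j).eval c * (y - c) ^ j) < V.valuation (p : Ω) :=
    fun c hcK hle => hadm c hcK (hT' c hcK hle).1
  have hkap : ∀ c ∈ K, V.valuation (y - c) ≤ V.valuation (y - T') →
      ∀ j ∈ range (N + 1), h j ≠ 0 → V.valuation ((h j).eval c) = V.valuation ((h j).eval y) :=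
    fun c hcK hle j hj hj0 => (hT' c hcK hle).2 j hj hj0
  /- is there a coincidence? -/
  by_cases hco : ∃ M e, 1 ≤ M ∧ 1 ≤ e ∧ M * p ^ e ≤ N ∧ h M ≠ 0 ∧ h (M * p ^ e) ≠ 0 ∧
      V.valuation ((h M).eval y) ^ (p ^ e) =
        V.valuation (p : Ω) ^ (∑ k ∈ range e, p ^ (k + 1)) * V.valuation ((h (M * p ^ e)).eval y)
  · obtain ⟨M, e, hM, he, hL, hM0, hL0, hcoeq⟩ := hco
    have hMr : M ∈ range (N + 1) := mem_range.mpr (by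
      have : M ≤ M * p ^ e := Nat.le_mul_of_pos_right M (pow_pos hpr.pos e); omega)
    have hLr : M * p ^ e ∈ range (N + 1) := mem_range.mpr (by omega)
    -- the coincidence in the form needed by `merge_step`
    have hcoinc : ∀ c ∈ K, V.valuation (y - c) ≤ V.valuation (y - T') →
        V.valuation ((fun x : Ω => (-x / p) ^ p)^[e] ((h M).eval c * (y - c) ^ M)) =
          V.valuation ((h (M * p ^ e)).eval c * (y - c) ^ (M * p ^ e)) := by
      intro c hcK hle
      have hne0 : V.valuation (p : Ω) ^ (∑ k ∈ range e, p ^ (k + 1)) ≠ 0 := pow_ne_zero _ hvp0.ne'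
      apply mul_right_cancel₀ hne0
      rw [valuation_theta_iterate_mul V hp0, map_mul, map_mul, map_pow, map_pow, mul_pow, ← pow_mul,
        hkap c hcK hle M hMr hM0, hkap c hcK hle _ hLr hL0, hcoeq]
      ac_rfl
    obtain ⟨h', hh'K, hadm'', hss⟩ := merge_step V hKF hF hCK hC hp0 hvp hyF h N hhK hadm' hM he hL hM0 hL0 hcoinc
    exact ih _ (hcard ▸ Finset.card_lt_card hss) h' T' hh'K hT'K hadm'' rfl
  · push Not at hco
    exact terminal_step V hKF hF hCK hC hp0 hvp hyF hrt hrtK hyK hval hres h N hhK hT'K hadm' hkap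
      (fun M e hM he hL hM0 hL0 => hco M e hM he hL hM0 hL0) hnt

end Cascade

/-! ### The second case of Lemma 4.3 -/

section Setting

variable [IsAlgClosed Ω] {p : ℕ} [hp : Fact p.Prime] [CharZero Ω] [CharP (ResidueField V) p]
  (K : Subfield Ω) [IsSepClosed K]

/-- **Kuhlmann 2019, Lemma 4.3, second case.** Setting of `(H43)`: `K ≤ Ω` separably closed
of characteristic `0` (rank one is not needed in this case), `char Ωv = p`, `y` transcendental over `K` with
`(K(y)|K, v)` immediate and `v(y) = 1`, `g̃` over `K` all of whose coefficients have value
`< v(p)` ("all monomials in `g̃(y)` have value `> vp`"), `1 + g̃(y)` not a `p`-th power in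
`K(y)^h`. Then there are `c₂ ∈ K`, `0 ≠ b ∈ K` with `v((y − c₂)/b) = 1` and `G` over `K` with
`1 + g̃(y) ∈ (1 + G((y−c₂)/b))·(K(y)^h)^{×p}` and an index `i₀ ≥ 1` prime to `p` whose
coefficient strictly dominates all other coefficients of positive index. PROVED: the cascade
started with the Taylor family `h_j = g̃_j` (Hasse–Schmidt derivatives) at the threshold where
`v(y − c) < 1`. [cite: Kuhlmann2019, Lemma 4.3] -/
theorem normalForm43_caseTwo {y : Ω} (hy : Transcendental K y)
    (himm : IsImmediateOver V K (Subfield.closure ((K : Set Ω) ∪ {y}))) (hvy : V.valuation y = 1)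
    {g : Polynomial Ω} (hgK : ∀ k, g.coeff k ∈ K) (hg : ∀ k, V.valuation (g.coeff k) < V.valuation (p : Ω))
    (hnt : ¬ ∃ w ∈ henselization V (Subfield.closure ((K : Set Ω) ∪ {y})), w ^ p = 1 + g.eval y) :
    ∃ c₂ ∈ K, ∃ b ∈ K, b ≠ 0 ∧ V.valuation ((y - c₂) / b) = 1 ∧
      ∃ G : Polynomial Ω, (∀ k, G.coeff k ∈ K) ∧
        (∃ w ∈ henselization V (Subfield.closure ((K : Set Ω) ∪ {y})), w ≠ 0 ∧
          1 + g.eval y = (1 + G.eval ((y - c₂) / b)) * w ^ p) ∧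
        (∃ i₀, 0 < i₀ ∧ ¬ p ∣ i₀ ∧ G.coeff i₀ ≠ 0 ∧
          ∀ i, 0 < i → i ≠ i₀ → V.valuation (G.coeff i) < V.valuation (G.coeff i₀)) := by
  classical
  have hpr : p.Prime := hp.out
  set Ky : Subfield Ω := Subfield.closure ((K : Set Ω) ∪ {y}) with hKy
  set F : Subfield Ω := henselization V Ky with hFdef
  have hKKy : K ≤ Ky := fun c hc => Subfield.subset_closure (Or.inl hc)
  have hKF : K ≤ F := hKKy.trans (le_henselization V Ky)
  have hyKy : y ∈ Ky := Subfield.subset_closure (Or.inr rfl)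
  have hyF : y ∈ F := le_henselization V Ky hyKy
  have hF : IsHenselianField F (V.comap (algebraMap F Ω)) :=
    Kuhlmann2010HenselizationIsHenselian_holds Ω V Ky
  have hKalg : IsAlgClosed K := isAlgClosed_of_isSepClosed_of_charZero K
  obtain ⟨C, hCK, hC⟩ := exists_C_pow_pred_eq K hKalg hpr
  have hp0 : (p : Ω) ≠ 0 := Nat.cast_ne_zero.mpr hpr.ne_zero
  have hvp : V.valuation (p : Ω) < 1 := valuation_natCast_lt_one_of_charP V p
  have hvp0 : 0 < V.valuation (p : Ω) := (Valuation.pos_iff _).mpr hp0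
  obtain ⟨rt, hrt, hrtK⟩ := exists_root_function K hKalg hpr.pos
  -- transcendence in polynomial form, `y ∉ K`, immediateness as `hval`, `hres`, and `h3`
  have htrans : ∀ P : Polynomial Ω, (∀ k, P.coeff k ∈ K) → P.eval y = 0 → P = 0 := by
    intro P hP hPy
    obtain ⟨P', hP'⟩ : ∃ P' : Polynomial K, P'.map (algebraMap K Ω) = P :=
      (Polynomial.mem_lifts P).mp ((Polynomial.lifts_iff_coeff_lifts P).mpr
        fun k => ⟨⟨P.coeff k, hP k⟩, rfl⟩)
    by_contra hP0
    refine hy ⟨P', fun h => hP0 ?_, ?_⟩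
    · rw [← hP', h, Polynomial.map_zero]
    · rw [Polynomial.aeval_def, ← Polynomial.eval_map, hP', hPy]
  have hyK : y ∉ K := not_mem_of_forall_eval_eq_zero K htrans
  have hval : ∀ w ∈ Ky, w ≠ 0 → ∃ b ∈ K, V.valuation w = V.valuation b := himm.1
  have hres : ∀ w ∈ Ky, w ∈ V → ∃ c ∈ K, V.valuation (w - c) < 1 := by
    intro w hw hwV
    have hrw : residue V ⟨w, hwV⟩ ∈ resField V K := himm.2 (residue_mem_resField V ⟨w, hwV⟩ hw)
    obtain ⟨c, hcK, hcw⟩ := (mem_resField_iff V K _).mp hrw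
    refine ⟨c, hcK, ?_⟩
    have h0 : residue V (⟨w, hwV⟩ - c) = 0 := by rw [map_sub, hcw, sub_self]
    exact (ValuationSubring.valuation_lt_one_iff V (⟨w, hwV⟩ - c)).mp ((residue_eq_zero_iff _).mp h0)
  have h3 := kaplansky_condition_of_isSepClosed V K htrans hval hres
  /- the initial family and threshold -/
  set N := g.natDegree with hNdef
  set h₀ : ℕ → Polynomial Ω := fun j => hasseDeriv j g with hh₀
  have hh₀K : ∀ j k, (h₀ j).coeff k ∈ K := fun j k => coeff_hasseDeriv_mem K hgK j k
  have hyV : y ∈ V := (V.valuation_le_one_iff y).mp hvy.le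
  obtain ⟨c₀, hc₀K, hc₀⟩ := hres y hyKy hyV
  have hadm : ∀ c ∈ K, V.valuation (y - c) ≤ V.valuation (y - c₀) →
      (∃ w ∈ F, w ≠ 0 ∧ 1 + g.eval y = (1 + ∑ j ∈ range (N + 1), (h₀ j).eval c * (y - c) ^ j) * w ^ p) ∧
      ∀ j ∈ range (N + 1), V.valuation ((h₀ j).eval c * (y - c) ^ j) < V.valuation (p : Ω) := by
    intro c hcK hle
    have hyc : V.valuation (y - c) < 1 := hle.trans_lt hc₀
    have hvc : V.valuation c = 1 := by
      have : c = y - (y - c) := by ring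
      rw [this, Valuation.map_sub_eq_of_lt_left _ (by rwa [hvy]), hvy]
    refine ⟨⟨1, F.one_mem, one_ne_zero, ?_⟩, fun j _ => ?_⟩
    · -- Taylor expansion
      rw [one_pow, mul_one]
      congr 1
      have h1 : g.eval y = (taylor c g).eval (y - c) := by rw [taylor_eval, sub_add_cancel]
      rw [h1, eval_eq_sum_range' (p := taylor c g) (n := N + 1)
        (by rw [natDegree_taylor]; exact Nat.lt_succ_self _)]
      refine sum_congr rfl fun j _ => ?_
      rw [taylor_coeff]
    · rw [map_mul, map_pow]
      have h1 : V.valuation ((h₀ j).eval c) < V.valuation (p : Ω) :=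
        valuation_eval_lt_of_coeff_lt V (valuation_hasseDeriv_coeff_lt V hg j) hvc.le
      calc V.valuation ((h₀ j).eval c) * V.valuation (y - c) ^ j ≤ V.valuation ((h₀ j).eval c) * 1 :=
            mul_le_mul' le_rfl (pow_le_one₀ zero_le hyc.le)
        _ < V.valuation (p : Ω) := by rw [mul_one]; exact h1
  exact cascade V hKF hF hCK hC hp0 hvp hyF hrt hrtK hyK htrans hval hres h3 hnt N _ h₀ c₀ hh₀K hc₀K hadm rfl

end Setting

end Literature.AlgebraicGeometry.Resolution

end
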